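import Summits.QuantumAdvantage.QuantumAdvantage.Theorems.WbwVerifiableLineNoSpeedup.Negative.QueryReindex
import Summits.QuantumAdvantage.QuantumAdvantage.Theorems.WbwVerifiableLineNoSpeedup.Negative.LoadBearing
import Literature.Computability.QuantumComplexity.GroverSearch

/-!
# Grover-branch tightness of the crux `WbwVerifiableLineNoSpeedup`: `Q_{1/3}(SVL_{m,T}) ≤ 76 √(2^(m-1))`

Support / negative lemmas for the crux `WhiteBoxWalk.WbwVerifiableLineNoSpeedup`
(stmt-QuantumAdvantage-2239), from the refuter work file
`Cruxes/WbwVerifiableLineNoSpeedup/Disproof.lean` §5: the sink bit `svlSinkBit m T` is LITERALLY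
the OR of the `2^(m-1)` bits `V(x, T)`, `x` odd, of the input table, so by the bit-copy reduction
(`QueryReindex.quantumQueryComplexityOn_le_of_reindex`) and the tree's Grover search
(`quantumQueryComplexity_orFn_le`: `Q₂(OR_N) ≤ 76 √N`) we get
`Q_{1/3}(SVL_{m,T}) ≤ Q_{1/3}(OR_{2^(m-1)}) ≤ 76 √(2^(m-1))` for `m ≥ 1`
(`quantumQueryComplexityOn_svl_le_sqrt`). Consequences: the `√(2^m)` branch of the crux's
`min (T+1) √(2^m)` is attained up to constants, and the strengthening of the crux keeping only
the WALK branch, `∃ c > 0, ∀ m T, hyps → c (T+1)/m ≤ Q`, is FALSE (`not_walkBranchOnly`, witness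
`T = 2^(m-1) - 1`). Together with `Tightness.not_groverBranchOnly`: both branches of the `min` are
necessary. Sorry-free.
-/

noncomputable section

set_option linter.dupNamespace false

namespace Summit.QuantumAdvantage.QuantumAdvantage.Theorems.WbwVerifiableLineNoSpeedup.Negative.SvlGrover

open Literature.Computability.Cryptography Literature.Computability.QuantumComplexity
  Literature.Computability.Complexity
open Summit.QuantumAdvantage.QuantumAdvantage.Theorems.WbwVerifiableLineNoSpeedup.Negative
open Summit.QuantumAdvantage.QuantumAdvantage.Theorems.WbwVerifiableLineNoSpeedup.Negative.QueryReindex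

variable {m T : ℕ}

/-- `2^m = 2 · 2^(m-1)` for `m ≥ 1`. [folklore] -/
theorem two_pow_eq_two_mul (hm : 1 ≤ m) : 2 ^ m = 2 * 2 ^ (m - 1) := by
  obtain ⟨m', rfl⟩ : ∃ m', m = m' + 1 := ⟨m - 1, by omega⟩
  rw [Nat.add_sub_cancel, pow_succ, mul_comm]

/-- The odd name `2y + 1 < 2^m` (`m ≥ 1`). [folklore] -/
def oddName (hm : 1 ≤ m) (y : Fin (2 ^ (m - 1))) : Fin (2 ^ m) :=
  ⟨2 * y.val + 1, by have := two_pow_eq_two_mul hm; omega⟩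

/-- Source map: the `y`-th bit of the OR instance is the bit `V(2y+1, T)` of the SVL table. [folklore] -/
def groverSrc (hm : 1 ≤ m) (T : ℕ) (y : Fin (2 ^ (m - 1))) : Fin (2 ^ m * m + 2 ^ m * (T + 1)) :=
  svlVerifyIndex m T (oddName hm y) (Fin.last T)

/-- The sink bit of ANY table is the OR of the bits `V(x, T)`, `x` odd. [folklore] -/
theorem orFn_comp_groverSrc (hm : 1 ≤ m) (t : SVLInput m T) :
    orFn (2 ^ (m - 1)) (t ∘ groverSrc hm T) = svlSinkBit m T t := by
  unfold orFn svlSinkBit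
  rw [decide_eq_decide]
  constructor
  · rintro ⟨y, hy⟩
    exact ⟨oddName hm y, hy, by simp [oddName]⟩
  · rintro ⟨x, hx, hodd⟩
    refine ⟨⟨x.val / 2, ?_⟩, ?_⟩
    · have := x.isLt; have h2 := two_pow_eq_two_mul hm; omega
    · have hx' : oddName hm ⟨x.val / 2, by have := x.isLt; have h2 := two_pow_eq_two_mul hm; omega⟩ = x :=
        Fin.ext (by simp only [oddName]; omega)
      simp only [Function.comp_apply, groverSrc, hx']
      exact hx

/-- **`Q_ε(SVL_{m,T}) ≤ Q_ε(OR_{2^(m-1)})`** for every `ε ≥ 0` and `m ≥ 1`: search the odd half of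
the last column of `V`. [folklore] -/
theorem quantumQueryComplexityOn_svl_le_orFn {ε : ℝ} (hε : 0 ≤ ε) (hm : 1 ≤ m) :
    quantumQueryComplexityOn ε (svlPromise m T) (svlSinkBit m T) ≤
      quantumQueryComplexity ε (orFn (2 ^ (m - 1))) :=
  quantumQueryComplexityOn_le_of_reindex hε (groverSrc hm T) (D₁ := Set.univ)
    (fun _ _ => Set.mem_univ _) (fun t _ => orFn_comp_groverSrc hm t)

/-- **Grover-branch tightness**: `Q_{1/3}(SVL_{m,T}) ≤ 76 √(2^(m-1)) (≤ 54 √(2^m))` for `m ≥ 1`,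
by the tree's Grover search (`quantumQueryComplexity_orFn_le`). [folklore] -/
theorem quantumQueryComplexityOn_svl_le_sqrt (hm : 1 ≤ m) :
    (quantumQueryComplexityOn (1 / 3) (svlPromise m T) (svlSinkBit m T) : ℝ) ≤
      76 * Real.sqrt (2 ^ (m - 1)) := by
  have h1 : (quantumQueryComplexityOn (1 / 3) (svlPromise m T) (svlSinkBit m T) : ℝ) ≤
      (quantumQueryComplexity (1 / 3) (orFn (2 ^ (m - 1))) : ℝ) := by
    exact_mod_cast quantumQueryComplexityOn_svl_le_orFn (by norm_num) hm
  have h2 := quantumQueryComplexity_orFn_le (N := 2 ^ (m - 1)) Nat.one_le_two_pow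
  push_cast at h2
  exact h1.trans h2

/-- `Q_{1/3}(SVL_{m,T}) ≤ 54 √(2^m)` for `m ≥ 1` (since `76/√2 < 54`). [folklore] -/
theorem svlQ_le_sqrt (hm : 1 ≤ m) : (svlQ m T : ℝ) ≤ 54 * Real.sqrt (2 ^ m) := by
  have h := quantumQueryComplexityOn_svl_le_sqrt (T := T) hm
  have hs : Real.sqrt (2 ^ m) = Real.sqrt 2 * Real.sqrt (2 ^ (m - 1)) := by
    rw [← Real.sqrt_mul (by norm_num)]
    congr 1
    obtain ⟨m', rfl⟩ : ∃ m', m = m' + 1 := ⟨m - 1, by omega⟩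
    rw [Nat.add_sub_cancel, pow_succ, mul_comm]
  have h2 : (1.41 : ℝ) ≤ Real.sqrt 2 := by
    rw [show (1.41 : ℝ) = Real.sqrt (1.41 ^ 2) from (Real.sqrt_sq (by norm_num)).symm]
    exact Real.sqrt_le_sqrt (by norm_num)
  have h0 : 0 ≤ Real.sqrt (2 ^ (m - 1)) := Real.sqrt_nonneg _
  have h3 := mul_le_mul_of_nonneg_right h2 h0
  calc (svlQ m T : ℝ) ≤ 76 * Real.sqrt (2 ^ (m - 1)) := h
    _ ≤ 54 * (Real.sqrt 2 * Real.sqrt (2 ^ (m - 1))) := by nlinarith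
    _ = 54 * Real.sqrt (2 ^ m) := by rw [hs]

/-- `k² ≤ 2^k` for `k ≥ 4`. [folklore] -/
theorem sq_le_two_pow {k : ℕ} (hk : 4 ≤ k) : k ^ 2 ≤ 2 ^ k := by
  induction k, hk using Nat.le_induction with
  | base => norm_num
  | succ k hk ih =>
    have h1 : 2 * k + 1 ≤ k ^ 2 := by nlinarith
    calc (k + 1) ^ 2 = k ^ 2 + (2 * k + 1) := by ring
      _ ≤ k ^ 2 + k ^ 2 := Nat.add_le_add_left h1 _
      _ ≤ 2 ^ k + 2 ^ k := Nat.add_le_add ih ih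
      _ = 2 ^ (k + 1) := by ring

/-- **Refuted strengthening: the Grover branch of the `min` is necessary.** The crux with
`min (T+1) √(2^m)` replaced by its walk branch `T + 1` alone is FALSE: at `m = 2k+1`,
`T = 2^(2k) - 1` (so `T + 1 = 2^(m-1)`), `Q ≤ 76 √(2^(2k)) = 76 · 2^k` while
`c (T+1)/m = c 4^k/(2k+1)`. [folklore] -/
theorem not_walkBranchOnly :
    ¬ ∃ c : ℝ, 0 < c ∧ ∀ m T : ℕ, 2 ≤ m → 1 ≤ T → T + 1 ≤ 2 ^ (m - 1) →
      c * ((T : ℝ) + 1) / m ≤ (svlQ m T : ℝ) := by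
  rintro ⟨c, hc, h⟩
  obtain ⟨k, hk⟩ := exists_nat_gt (max 4 (228 / c))
  have hk4 : 4 ≤ k := by
    have : (4 : ℝ) < k := lt_of_le_of_lt (le_max_left _ _) hk
    exact_mod_cast this.le
  have hkc : 228 / c < k := lt_of_le_of_lt (le_max_right _ _) hk
  have hkpos : (0 : ℝ) < k := by exact_mod_cast (lt_of_lt_of_le (by norm_num) hk4)
  -- parameters m = 2k+1, T = 2^(2k) - 1
  have hT1 : 1 ≤ 2 ^ (2 * k) - 1 := by
    have : 2 ≤ 2 ^ (2 * k) := by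
      calc 2 = 2 ^ 1 := rfl
        _ ≤ 2 ^ (2 * k) := Nat.pow_le_pow_right (by norm_num) (by omega)
    omega
  have hTm : 2 ^ (2 * k) - 1 + 1 ≤ 2 ^ (2 * k + 1 - 1) := by
    rw [Nat.add_sub_cancel, Nat.sub_add_cancel Nat.one_le_two_pow]
  have hQ := h (2 * k + 1) (2 ^ (2 * k) - 1) (by omega) hT1 hTm
  have hup : (svlQ (2 * k + 1) (2 ^ (2 * k) - 1) : ℝ) ≤ 76 * Real.sqrt (2 ^ (2 * k + 1 - 1)) :=
    quantumQueryComplexityOn_svl_le_sqrt (by omega)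
  rw [Nat.add_sub_cancel] at hup
  have hsqrt : Real.sqrt (2 ^ (2 * k)) = (2 : ℝ) ^ k := by
    have h22 : (2 : ℝ) ^ (2 * k) = ((2 : ℝ) ^ k) ^ 2 := by rw [← pow_mul, mul_comm]
    rw [h22]
    exact Real.sqrt_sq (by positivity)
  rw [hsqrt] at hup
  have hTR : ((2 ^ (2 * k) - 1 : ℕ) : ℝ) + 1 = (2 : ℝ) ^ k * (2 : ℝ) ^ k := by
    rw [Nat.cast_sub Nat.one_le_two_pow]
    push_cast
    rw [← pow_add, show k + k = 2 * k by ring]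
    ring
  rw [hTR] at hQ
  have hmR : ((2 * k + 1 : ℕ) : ℝ) = 2 * k + 1 := by push_cast; ring
  rw [hmR] at hQ
  -- c 4^k/(2k+1) ≤ 76 · 2^k  ⇒  c 2^k ≤ 76 (2k+1) ≤ 228 k  ⇒ (2^k ≥ k²)  c k ≤ 228
  have h2k : (k : ℝ) ^ 2 ≤ (2 : ℝ) ^ k := by exact_mod_cast sq_le_two_pow hk4
  have hpos2 : (0 : ℝ) < (2 : ℝ) ^ k := by positivity
  have hm0 : (0 : ℝ) < 2 * k + 1 := by positivity
  have h1 : c * ((2 : ℝ) ^ k * (2 : ℝ) ^ k) ≤ 76 * (2 : ℝ) ^ k * (2 * k + 1) := by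
    have := (div_le_iff₀ hm0).1 (hQ.trans hup)
    linarith
  have h3 : c * (2 : ℝ) ^ k ≤ 76 * (2 * k + 1) := by
    have := mul_le_mul_of_nonneg_right h1 (le_of_lt (inv_pos.2 hpos2))
    field_simp at h1
    nlinarith [mul_pos hc hpos2]
  have h4 : c * (k : ℝ) ^ 2 ≤ 228 * k := by
    have hk1 : (1 : ℝ) ≤ k := by exact_mod_cast le_trans (by norm_num) hk4
    nlinarith [mul_le_mul_of_nonneg_left h2k hc.le]
  have hck : 228 < c * k := by
    have := (div_lt_iff₀ hc).1 hkc
    linarith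
  nlinarith

end Summit.QuantumAdvantage.QuantumAdvantage.Theorems.WbwVerifiableLineNoSpeedup.Negative.SvlGrover
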